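import Summits.ABC.ABC.Theorems.PrimePowerRadical.Negative.Orders
import Summits.ABC.ABC.Theorems.PrimePowerRadical.Negative.DoubleWall

/-!
# Metric calibration (i): the order-weighted count of the bases at which an odd prime is Wieferich

Stub `stub_metric_levelTwo_of` of the line `Sketch` (card `adelic-brjuno-summability`, crux
stmt-ABC-1648, wave 2: the metric calibration of the open stub `stub_wdc`,
`T_q = Σ_p (W_p(q) − 1) log p / ord_p(q) < ∞`).

With `W_p(q) := wieferichLevel q p` and `ord_p(q) := ordMod q p` we prove, for an odd prime `p` and
every `Q`, `Σ_{q < Q, W_p(q) ≥ 2} 1 / ord_p(q) ≤ τ(p − 1) · (Q / p² + 1)`, GIVEN as a hypothesis the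
root count `H₁` (`x^n ≡ 1 (mod p^k)` has `≤ n` solutions in `[0, p^k)`); the Hensel-uniqueness
hypothesis `H₂` of the registered signature is carried but not needed.

Proof. A base `q` of level `≥ 2` has `q ≥ 2`, `p ∤ q`, so `e := ord_p(q)` divides `p − 1`, and by
De Leon's lemma in exact form (`Negative.pow_wieferichLevel_dvd`: `p^{W_p(q)} ∣ q^e − 1`)
`q^e ≡ 1 (mod p²)`. Group the bases by `e ∈ (p − 1).divisors`: those with `ord_p(q) = e` reduce
mod `p²` into the `≤ e` roots of `x^e ≡ 1 (mod p²)` (`H₁`, `k = 2`), and each residue class mod `p²`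
has `≤ Q / p² + 1` members below `Q` (`Nat.count_modEq_card`); so the fibre of `e` has
`≤ e · (Q / p² + 1)` elements, each weighing `1 / e`, and there are `τ(p − 1)` fibres.

NOT here: the root count and Hensel uniqueness themselves (neighbour stubs `stub_card_roots_le`,
`stub_hensel_inj`), the higher-level tail `Σ_{q<Q} (W_p(q) − 2)⁺` (`stub_metric_tail_of`) and the
assembly over `p ≤ x` (`stub_metric_wdc_of`).
-/

noncomputable section

-- `Summit.<Summit>.<Problem>` is the mandated summit-side namespace (CONVENTIONS §2); for the
-- single-conjunct summit `ABC` the two coincide, so the duplicate `ABC.ABC` is deliberate.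
set_option linter.dupNamespace false

namespace Summit.ABC.ABC.Theorems.PrimePowerRadical.Brjuno

open Literature.NumberTheory.DiophantineGeometry UniqueFactorizationMonoid
open Summit.ABC.ABC.Theses.IneffectiveSubspace
open Summit.ABC.ABC.Theorems.PrimePowerRadical.Negative
open scoped BigOperators

/-- A base of Wieferich level `≥ 2` at the prime `p` is `≥ 2` and prime to `p` (otherwise the level
is `0`). -/
theorem lv2_two_le_and_not_dvd {q p : ℕ} (hp : p.Prime) (hW : 2 ≤ wieferichLevel q p) :
    2 ≤ q ∧ ¬ p ∣ q := by
  have hq : 2 ≤ q := by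
    by_contra hlt
    have h1 : q ^ (2 * (p - 1)) ≤ 1 := pow_le_one₀ (Nat.zero_le q) (by omega)
    have h0 : q ^ (2 * (p - 1)) - 1 = 0 := by omega
    unfold wieferichLevel at hW
    rw [h0, padicValNat_zero_right] at hW
    omega
  refine ⟨hq, fun hpq => ?_⟩
  have h := wieferichLevel_eq_zero_of_dvd hp (by omega) hpq
  omega

/-- Level `≥ 2` at the odd prime `p` gives `q^{ord_p(q)} ≡ 1 (mod p²)` (De Leon's lemma, exact form). -/
theorem lv2_pow_ordMod_modEq {q p : ℕ} (hp : p.Prime) (hp2 : p ≠ 2) (hW : 2 ≤ wieferichLevel q p) :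
    q ^ ordMod q p ≡ 1 [MOD p ^ 2] := by
  obtain ⟨hq, hpq⟩ := lv2_two_le_and_not_dvd hp hW
  have h1 : p ^ 2 ∣ q ^ ordMod q p - 1 :=
    (pow_dvd_pow p hW).trans (pow_wieferichLevel_dvd hq hp hp2 hpq)
  have h2 : 1 ≤ q ^ ordMod q p := Nat.one_le_pow _ _ (by omega)
  exact ((Nat.modEq_iff_dvd' h2).mpr h1).symm

/-- Below `Q`, each residue class modulo `m > 0` has at most `Q / m + 1` members. -/
private theorem lv2_card_filter_mod_le {Q m : ℕ} (hm : 0 < m) (a : ℕ) :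
    ((Finset.range Q).filter (fun q => q % m = a)).card ≤ Q / m + 1 := by
  calc ((Finset.range Q).filter (fun q => q % m = a)).card
      ≤ ((Finset.range Q).filter (fun q => q ≡ a [MOD m])).card := by
        refine Finset.card_le_card fun q hq => ?_
        obtain ⟨hqQ, hqa⟩ := Finset.mem_filter.mp hq
        refine Finset.mem_filter.mpr ⟨hqQ, ?_⟩
        rw [← hqa]
        exact (Nat.mod_modEq q m).symm
    _ = Q.count (· ≡ a [MOD m]) := (Nat.count_eq_card_filter_range _ _).symm
    _ = Q / m + if a % m < Q % m then 1 else 0 := Nat.count_modEq_card Q hm a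
    _ ≤ Q / m + 1 := by split_ifs <;> omega

/-- For `e ≥ 1`, the bases `q < Q` of level `≥ 2` at the odd prime `p` with `ord_p(q) = e` number at
most `(Q / p² + 1) · e`: they reduce mod `p²` into the `≤ e` roots of `x^e ≡ 1 (mod p²)` (`H₁`), and
each residue class mod `p²` has `≤ Q / p² + 1` members below `Q`. -/
theorem lv2_card_fibre_le
    (H₁ : ∀ p k n : ℕ, p.Prime → p ≠ 2 → 1 ≤ k → 1 ≤ n →
      ((Finset.range (p ^ k)).filter (fun a => a ^ n ≡ 1 [MOD p ^ k])).card ≤ n)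
    {p : ℕ} (hp : p.Prime) (hp2 : p ≠ 2) (Q : ℕ) {e : ℕ} (he : 1 ≤ e) :
    (((Finset.range Q).filter (fun q => 2 ≤ wieferichLevel q p)).filter
        (fun q => ordMod q p = e)).card ≤ (Q / p ^ 2 + 1) * e := by
  have hm : 0 < p ^ 2 := pow_pos hp.pos 2
  refine le_trans (Finset.card_le_mul_card_image_of_maps_to (f := fun q => q % p ^ 2)
    (t := (Finset.range (p ^ 2)).filter (fun a => a ^ e ≡ 1 [MOD p ^ 2])) ?_ _ ?_)
    (Nat.mul_le_mul_left _ (H₁ p 2 e hp hp2 (by norm_num) he))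
  · intro q hq
    simp only [Finset.mem_filter, Finset.mem_range] at hq
    obtain ⟨⟨-, hW⟩, hqe⟩ := hq
    refine Finset.mem_filter.mpr ⟨Finset.mem_range.mpr (Nat.mod_lt _ hm), ?_⟩
    rw [← hqe]
    exact ((Nat.mod_modEq q (p ^ 2)).pow _).trans (lv2_pow_ordMod_modEq hp hp2 hW)
  · intro b _
    refine le_trans (Finset.card_le_card ?_) (lv2_card_filter_mod_le hm b)
    intro q hq
    simp only [Finset.mem_filter, Finset.mem_range] at hq ⊢
    exact ⟨hq.1.1.1, hq.2⟩

/-- **stub_metric_levelTwo_of (metric (i)).** For an odd prime `p`: the order-weighted count of the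
bases `q < Q` at which `p` is Wieferich (`W_p(q) ≥ 2`) is `≤ τ(p−1)·(Q/p² + 1)` — given the root
count `H₁` (the Hensel-uniqueness hypothesis `H₂` is part of the registered interface; De Leon's
exact form makes it unnecessary here). -/
theorem stub_metric_levelTwo_of
    (H₁ : ∀ p k n : ℕ, p.Prime → p ≠ 2 → 1 ≤ k → 1 ≤ n →
      ((Finset.range (p ^ k)).filter (fun a => a ^ n ≡ 1 [MOD p ^ k])).card ≤ n)
    (H₂ : ∀ p n a b : ℕ, p.Prime → ¬ p ∣ n → a ^ n ≡ 1 [MOD p ^ 2] → b ^ n ≡ 1 [MOD p ^ 2] →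
      a ≡ b [MOD p] → a ≡ b [MOD p ^ 2])
    {p : ℕ} (hp : p.Prime) (hp2 : p ≠ 2) (Q : ℕ) :
    (∑ q ∈ (Finset.range Q).filter (fun q => 2 ≤ wieferichLevel q p), (1 : ℝ) / (ordMod q p : ℝ)) ≤
      ((p - 1).divisors.card : ℝ) * ((Q : ℝ) / (p : ℝ) ^ 2 + 1) := by
  have _h₂ := H₂
  set F := (Finset.range Q).filter (fun q => 2 ≤ wieferichLevel q p)
  set D := (p - 1).divisors
  -- the order of a base of level ≥ 2 divides p - 1
  have hmaps : ∀ q ∈ F, ordMod q p ∈ D := by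
    intro q hq
    obtain ⟨-, hW⟩ := Finset.mem_filter.mp hq
    obtain ⟨-, hpq⟩ := lv2_two_le_and_not_dvd hp hW
    exact Nat.mem_divisors.mpr ⟨ordMod_dvd_sub_one hp hpq, by have := hp.two_le; omega⟩
  -- the real fibre bound
  have hcN : ((Q / p ^ 2 + 1 : ℕ) : ℝ) ≤ (Q : ℝ) / (p : ℝ) ^ 2 + 1 := by
    have h : ((Q / p ^ 2 : ℕ) : ℝ) ≤ (Q : ℝ) / ((p ^ 2 : ℕ) : ℝ) := Nat.cast_div_le
    push_cast at h ⊢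
    linarith
  have hfib : ∀ e ∈ D,
      ∑ q ∈ F with ordMod q p = e, (1 : ℝ) / (e : ℝ) ≤ (Q : ℝ) / (p : ℝ) ^ 2 + 1 := by
    intro e he
    have he1 : 1 ≤ e := Nat.pos_of_mem_divisors he
    have he0 : (e : ℝ) ≠ 0 := by exact_mod_cast (show e ≠ 0 by omega)
    rw [Finset.sum_const, nsmul_eq_mul]
    have hcard : (F.filter (fun q => ordMod q p = e)).card ≤ (Q / p ^ 2 + 1) * e :=
      lv2_card_fibre_le H₁ hp hp2 Q he1
    have hcardR :
        ((F.filter (fun q => ordMod q p = e)).card : ℝ) ≤ ((Q : ℝ) / (p : ℝ) ^ 2 + 1) * e :=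
      calc ((F.filter (fun q => ordMod q p = e)).card : ℝ)
          ≤ (((Q / p ^ 2 + 1) * e : ℕ) : ℝ) := by exact_mod_cast hcard
        _ = ((Q / p ^ 2 + 1 : ℕ) : ℝ) * e := by push_cast; ring
        _ ≤ ((Q : ℝ) / (p : ℝ) ^ 2 + 1) * e := mul_le_mul_of_nonneg_right hcN (Nat.cast_nonneg e)
    calc ((F.filter (fun q => ordMod q p = e)).card : ℝ) * (1 / e)
        ≤ ((Q : ℝ) / (p : ℝ) ^ 2 + 1) * e * (1 / e) :=
          mul_le_mul_of_nonneg_right hcardR (by positivity)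
      _ = (Q : ℝ) / (p : ℝ) ^ 2 + 1 := by field_simp
  calc ∑ q ∈ F, (1 : ℝ) / (ordMod q p : ℝ)
      = ∑ e ∈ D, ∑ q ∈ F with ordMod q p = e, (1 : ℝ) / (e : ℝ) :=
        (Finset.sum_fiberwise_of_maps_to' (g := fun q => ordMod q p) hmaps
          (fun e : ℕ => (1 : ℝ) / (e : ℝ))).symm
    _ ≤ ∑ _e ∈ D, ((Q : ℝ) / (p : ℝ) ^ 2 + 1) := Finset.sum_le_sum hfib
    _ = (D.card : ℝ) * ((Q : ℝ) / (p : ℝ) ^ 2 + 1) := by rw [Finset.sum_const, nsmul_eq_mul]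

end Summit.ABC.ABC.Theorems.PrimePowerRadical.Brjuno

end
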